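import Summits.QuantumFields.YangMills.Theorems.AlphaInputsT3ACv3OneBlockLiftBounds
import HarnessLib

/-!
# `AlphaInputsT3ACv3OneBlockLiftCurl` — (r1-ob) THE ONE-BLOCK LIFT, PART 4: ★ THE CURL BOUND `|curl (obLift A)(q)| ≤ 1728·‖A‖_{loc}/L^{2k}` — lane `pub-balaban3d` ∕ cell
# `ym3-torus`, seat alpha-2 (g6); kernel of record for the regional Newton route (★★OWNER g25 03:01:17Z, LEAD ★w1-19936 g2 03:02:18Z)

WHY.  The plaquette row of the Newton shell bounds the finest curls of the correction `R u`; for the one-block kernel the gauge part `Ψ·dχ` is curl-free and the product form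
`h(ρ_α)·Π tent(ρ_⊥)` is differentiated only ACROSS its direction, where the tents are `12/n`-Lipschitz and vanish on the block's transverse boundary (no face term): `|curl e⁰| ≤
(4/n)·(12/n)·4 = 192/n²`, `n = L^k`.  THIS FILE: `curlAt_obKernel_eq` (the gauge part drops out), `abs_comp_shift_sub_le` (the product form across one transverse step),
★ `abs_curlAt_obKernel_le (≤ 192/L^{2k})`, `curlAt_obKernel_eq_zero_of_ne` (support: the blocks of `z`, `z + e_μ`, `z + e_ν`), `curlAt_obLift_eq_sum`, ★★ `abs_curlAt_obLift_le_local`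
(`≤ 1728·M/L^{2k}`, `M` bounding `A` on the bonds issuing from those three blocks), `abs_curlAt_obLift_le`.
HONEST FRAMING.  Kernel estimates of explicit lattice functions (constants not optimised: numerics `≈ 34/L^{2k}` per kernel); count-neutral helper toward the (FL)∕KIN row `hLift` of
R3 2′∕2′χ (`stub_laneRecordsV3`, items 19935∕19936 — NOT proved here); registry untouched; nothing about d = 4, the continuum, or a mass gap; YM₃ on T³ is rung R3, not Clay.

References: T. Bałaban, Commun. Math. Phys. 109 (1987) 249–301 [Balaban1987RG1] ((0.3) p.252, (0.4)+(0.11) p.253); CMP 102 (1985) 277–309 [Balaban1985Variational] ((8) p.279).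
-/

set_option autoImplicit false

noncomputable section

namespace Summit.QuantumFields.YangMills.Theorems.AbelianEML.OneBlock

open scoped BigOperators
open Literature.MathematicalPhysics.QuantumFieldTheory.Balaban1983to89
open Literature.MathematicalPhysics.QuantumFieldTheory.Balaban1983to89.T3ContinuumYM3Torus
open Summit.QuantumFields.YangMills.Theorems.AbelianEML (curlAt)
open Summit.QuantumFields.YangMills.Theorems.AbelianEML.Shapes1D
open Summit.QuantumFields.YangMills.Theorems.AbelianEML.Tensor (rho form3 N0 nc sizes le_standing coarsen_eq_iff rho_shift_mod)
open Summit.QuantumFields.YangMills.Theorems.LinearLiftGauge (dgrad psiIter)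
open Summit.QuantumFields.YangMills.Theorems.LinearLiftSpread (curlAt_dgrad)
open Summit.QuantumFields.Balaban3D.Carriers (coarsen)

variable {F : T3Family} {K k : ℕ}

/-- **THE GAUGE PART IS CURL-FREE**: `curl e_{(y,α)} = curl e⁰_{(y,α)}`. [folklore] -/
theorem curlAt_obKernel_eq (y : Site (F.P K) k) (α : Fin 3) (z : Site (F.P K) 0) (μ ν : Fin 3) :
    curlAt (obKernel F K k y α) z μ ν = curlAt (e0 F K k y α) z μ ν := by
  have h := curlAt_dgrad (chiB F K k y) z μ ν
  simp only [curlAt, obKernel] at h ⊢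
  linear_combination (psiIter k (e0 F K k y α) y) * h

/-- The `α`-component of the product form as a site function. [cite: Balaban1985Variational, (8) p.279] -/
theorem e0_apply (y : Site (F.P K) k) (α : Fin 3) (b : PBond (F.P K) 0) :
    e0 F K k y α b = if b.dir = α then hS false (F.L ^ k) (N0 F K) (rho y b.src α) * ∏ i ∈ Finset.univ.erase α, tS (F.L ^ k) (N0 F K) (rho y b.src i) else 0 := rfl

/-- **THE PRODUCT FORM ACROSS ONE TRANSVERSE STEP**: for `β ≠ α`, moving the source by `e_β` changes `h(ρ_α)·Π_{i≠α} tent(ρ_i)` by at most `192/n²` (only the `β`-tent moves, by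
`≤ 12/n`; `|h| ≤ 4/n`, the other tent `≤ 4`). [cite: Balaban1985Variational, (8) p.279] -/
theorem abs_comp_shift_sub_le (hk : k ≤ K) (hn3 : 3 ≤ F.L ^ k) (y : Site (F.P K) k) {α β : Fin 3} (hβ : β ≠ α) (z : Site (F.P K) 0) :
    |hS false (F.L ^ k) (N0 F K) (rho y (z.shift β) α) * ∏ i ∈ Finset.univ.erase α, tS (F.L ^ k) (N0 F K) (rho y (z.shift β) i) -
      hS false (F.L ^ k) (N0 F K) (rho y z α) * ∏ i ∈ Finset.univ.erase α, tS (F.L ^ k) (N0 F K) (rho y z i)| ≤ 192 / ((F.L : ℝ) ^ k) ^ 2 := by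
  obtain ⟨h1, h2, h3⟩ := sizes (F := F) hk
  obtain ⟨m, hm, hm1⟩ := pow_odd (F := F) hn3
  have hcast : ((F.L ^ k : ℕ) : ℝ) = (F.L : ℝ) ^ k := by push_cast; ring
  have hLpos : (0 : ℝ) < (F.L : ℝ) ^ k := by rw [← hcast]; exact_mod_cast (show 0 < F.L ^ k by omega)
  -- the longitudinal factor does not move
  have hh : hS false (F.L ^ k) (N0 F K) (rho y (z.shift β) α) = hS false (F.L ^ k) (N0 F K) (rho y z α) := by
    apply hS_congr; rw [rho_shift_mod, if_neg (Ne.symm hβ), add_zero]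
  rw [hh, ← mul_sub, abs_mul]
  -- split the transverse product at `β`
  have hβmem : β ∈ Finset.univ.erase α := Finset.mem_erase.mpr ⟨hβ, Finset.mem_univ β⟩
  rw [← Finset.mul_prod_erase _ _ hβmem, ← Finset.mul_prod_erase (Finset.univ.erase α) (fun i => tS (F.L ^ k) (N0 F K) (rho y z i)) hβmem]
  have hrest : ∏ i ∈ (Finset.univ.erase α).erase β, tS (F.L ^ k) (N0 F K) (rho y (z.shift β) i) =
      ∏ i ∈ (Finset.univ.erase α).erase β, tS (F.L ^ k) (N0 F K) (rho y z i) := by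
    refine Finset.prod_congr rfl fun i hi => ?_
    have hiβ : i ≠ β := Finset.ne_of_mem_erase hi
    simp only [tS]; apply per_congr; rw [rho_shift_mod, if_neg hiβ, add_zero]
  rw [hrest, ← sub_mul, abs_mul]
  have hcard : ((Finset.univ.erase α).erase β).card = 1 := by
    rw [Finset.card_erase_of_mem hβmem, Finset.card_erase_of_mem (Finset.mem_univ α)]; simp
  have hP : |∏ i ∈ (Finset.univ.erase α).erase β, tS (F.L ^ k) (N0 F K) (rho y z i)| ≤ 4 := by
    rw [Finset.abs_prod]
    calc ∏ i ∈ (Finset.univ.erase α).erase β, |tS (F.L ^ k) (N0 F K) (rho y z i)| ≤ ∏ _i ∈ (Finset.univ.erase α).erase β, (4 : ℝ) := by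
          refine Finset.prod_le_prod (fun i _ => abs_nonneg _) fun i _ => ?_
          rw [abs_of_nonneg (tS_facts hm hm1 h1 h2 _).1]; exact (tS_facts hm hm1 h1 h2 _).2.1
      _ = 4 := by rw [Finset.prod_const, hcard, pow_one]
  have hstep : |tS (F.L ^ k) (N0 F K) (rho y (z.shift β) β) - tS (F.L ^ k) (N0 F K) (rho y z β)| ≤ 12 / ((F.L : ℝ) ^ k) := by
    rw [← hcast]; exact (tS_facts hm hm1 h1 h2 (rho y z β)).2.2 _ (by rw [rho_shift_mod, if_pos rfl])
  have hh' : |hS false (F.L ^ k) (N0 F K) (rho y z α)| ≤ 4 / ((F.L : ℝ) ^ k) := by rw [← hcast]; exact abs_hS_le h3 false _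
  calc |hS false (F.L ^ k) (N0 F K) (rho y z α)| *
        (|tS (F.L ^ k) (N0 F K) (rho y (z.shift β) β) - tS (F.L ^ k) (N0 F K) (rho y z β)| * |∏ i ∈ (Finset.univ.erase α).erase β, tS (F.L ^ k) (N0 F K) (rho y z i)|)
      ≤ 4 / (F.L : ℝ) ^ k * (12 / (F.L : ℝ) ^ k * 4) :=
        mul_le_mul hh' (mul_le_mul hstep hP (abs_nonneg _) (by positivity)) (by positivity) (by positivity)
    _ = 192 / ((F.L : ℝ) ^ k) ^ 2 := by field_simp; ring

/-- The product form on a bond of its own direction. [folklore] -/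
theorem e0_apply_self (y : Site (F.P K) k) (α : Fin 3) (z : Site (F.P K) 0) :
    e0 F K k y α ⟨z, α⟩ = hS false (F.L ^ k) (N0 F K) (rho y z α) * ∏ i ∈ Finset.univ.erase α, tS (F.L ^ k) (N0 F K) (rho y z i) := by
  rw [e0_apply]; exact if_pos rfl

/-- The product form vanishes on bonds of the other directions. [folklore] -/
theorem e0_apply_of_ne (y : Site (F.P K) k) {α μ : Fin 3} (h : μ ≠ α) (z : Site (F.P K) 0) : e0 F K k y α ⟨z, μ⟩ = 0 := by
  rw [e0_apply]
  split_ifs with h'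
  · exact absurd h' h
  · rfl

/-- **★ `|curl e_{(y,α)}(z; μ, ν)| ≤ 192/L^{2k}`** (`μ ≠ ν`). [cite: Balaban1985Variational, (8) p.279] -/
theorem abs_curlAt_obKernel_le (hk : k ≤ K) (hn3 : 3 ≤ F.L ^ k) (y : Site (F.P K) k) (α : Fin 3) (z : Site (F.P K) 0) {μ ν : Fin 3} (hμν : μ ≠ ν) :
    |curlAt (obKernel F K k y α) z μ ν| ≤ 192 / ((F.L : ℝ) ^ k) ^ 2 := by
  have hpos : (0 : ℝ) ≤ 192 / ((F.L : ℝ) ^ k) ^ 2 := by positivity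
  rw [curlAt_obKernel_eq]
  unfold curlAt
  by_cases hμ : μ = α
  · subst hμ
    have hν : ν ≠ μ := fun h => hμν h.symm
    rw [e0_apply_self, e0_apply_self, e0_apply_of_ne y hν, e0_apply_of_ne y hν, add_zero, sub_zero, abs_sub_comm]
    exact abs_comp_shift_sub_le hk hn3 y hν z
  · by_cases hν : ν = α
    · subst hν
      rw [e0_apply_self, e0_apply_self, e0_apply_of_ne y hμ, e0_apply_of_ne y hμ, zero_add, sub_zero]
      exact abs_comp_shift_sub_le hk hn3 y hμ z
    · rw [e0_apply_of_ne y hμ, e0_apply_of_ne y hμ, e0_apply_of_ne y hν, e0_apply_of_ne y hν]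
      simpa using hpos

/-- **SUPPORT OF THE CURL**: `curl e_{(y,α)}(z; μ, ν) = 0` unless `y` is the block of `z`, of `z + e_μ` or of `z + e_ν`. [cite: Balaban1987RG1, (0.3) p.252] -/
theorem curlAt_obKernel_eq_zero_of_ne (hk : k ≤ K) (y : Site (F.P K) k) (α : Fin 3) (z : Site (F.P K) 0) (μ ν : Fin 3)
    (h0 : coarsen k z ≠ y) (hμ : coarsen k (z.shift μ) ≠ y) (hν : coarsen k (z.shift ν) ≠ y) : curlAt (obKernel F K k y α) z μ ν = 0 := by
  rw [curlAt_obKernel_eq]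
  simp only [curlAt]
  rw [e0_eq_zero_of_ne hk y α ⟨z, μ⟩ h0, e0_eq_zero_of_ne hk y α ⟨z.shift μ, ν⟩ hμ, e0_eq_zero_of_ne hk y α ⟨z.shift ν, μ⟩ hν,
    e0_eq_zero_of_ne hk y α ⟨z, ν⟩ h0]
  ring

/-- The curl of the one-block lift is the `A`-weighted sum of the kernels' curls. [folklore] -/
theorem curlAt_obLift_eq_sum (A : PBond (F.P K) k → ℝ) (z : Site (F.P K) 0) (μ ν : Fin 3) :
    curlAt (obLift F K k A) z μ ν = ∑ c : PBond (F.P K) k, A c * curlAt (obKernel F K k c.src c.dir) z μ ν := by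
  simp only [curlAt, obLift, ← Finset.sum_add_distrib, ← Finset.sum_sub_distrib, ← mul_add, ← mul_sub]

/-- **★★ LOCAL CURL BOUND**: `|curl (obLift A)(z; μ, ν)| ≤ (1728/L^{2k})·M` when `|A| ≤ M` on the coarse bonds issuing from the blocks of `z`, `z + e_μ`, `z + e_ν` (`μ ≠ ν`).
[cite: Balaban1985Variational, (8) p.279; Balaban1987RG1, (0.11) p.253] -/
theorem abs_curlAt_obLift_le_local (hk : k ≤ K) (hn3 : 3 ≤ F.L ^ k) (A : PBond (F.P K) k → ℝ) (z : Site (F.P K) 0) {μ ν : Fin 3} (hμν : μ ≠ ν)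
    {M : ℝ} (hM0 : 0 ≤ M)
    (hM : ∀ (y : Site (F.P K) k) (α : Fin 3), (y = coarsen k z ∨ y = coarsen k (z.shift μ) ∨ y = coarsen k (z.shift ν)) → |A ⟨y, α⟩| ≤ M) :
    |curlAt (obLift F K k A) z μ ν| ≤ 1728 / ((F.L : ℝ) ^ k) ^ 2 * M := by
  classical
  rw [curlAt_obLift_eq_sum]
  -- re-index by `(source, direction)` and restrict the sources to the three blocks
  let e : Site (F.P K) k × Fin 3 ≃ PBond (F.P K) k := ⟨fun p => ⟨p.1, p.2⟩, fun c => (c.src, c.dir), fun _ => rfl, fun _ => rfl⟩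
  rw [← Equiv.sum_comp e, Fintype.sum_prod_type]
  simp only [e, Equiv.coe_fn_mk]
  set T : Finset (Site (F.P K) k) := {coarsen k z, coarsen k (z.shift μ), coarsen k (z.shift ν)} with hT
  have hzero : ∀ y ∉ T, ∑ α : Fin 3, A ⟨y, α⟩ * curlAt (obKernel F K k y α) z μ ν = 0 := by
    intro y hy
    have hy' : coarsen k z ≠ y ∧ coarsen k (z.shift μ) ≠ y ∧ coarsen k (z.shift ν) ≠ y := by
      simp only [hT, Finset.mem_insert, Finset.mem_singleton, not_or] at hy
      exact ⟨fun h => hy.1 h.symm, fun h => hy.2.1 h.symm, fun h => hy.2.2 h.symm⟩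
    exact Finset.sum_eq_zero fun α _ => by rw [curlAt_obKernel_eq_zero_of_ne hk y α z μ ν hy'.1 hy'.2.1 hy'.2.2, mul_zero]
  rw [← Finset.sum_subset (Finset.subset_univ T) fun y _ hy => hzero y hy]
  have hcardT : T.card ≤ 3 := by
    rw [hT]; exact (Finset.card_insert_le _ _).trans (Nat.succ_le_succ ((Finset.card_insert_le _ _).trans (by simp)))
  have hterm : ∀ y ∈ T, |∑ α : Fin 3, A ⟨y, α⟩ * curlAt (obKernel F K k y α) z μ ν| ≤ 3 * (M * (192 / ((F.L : ℝ) ^ k) ^ 2)) := by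
    intro y hy
    have hyT : y = coarsen k z ∨ y = coarsen k (z.shift μ) ∨ y = coarsen k (z.shift ν) := by
      simpa only [hT, Finset.mem_insert, Finset.mem_singleton] using hy
    calc |∑ α : Fin 3, A ⟨y, α⟩ * curlAt (obKernel F K k y α) z μ ν| ≤ ∑ α : Fin 3, |A ⟨y, α⟩ * curlAt (obKernel F K k y α) z μ ν| :=
          Finset.abs_sum_le_sum_abs _ _
      _ ≤ ∑ _α : Fin 3, M * (192 / ((F.L : ℝ) ^ k) ^ 2) := Finset.sum_le_sum fun α _ => by
          rw [abs_mul]; exact mul_le_mul (hM y α hyT) (abs_curlAt_obKernel_le hk hn3 y α z hμν) (abs_nonneg _) hM0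
      _ = 3 * (M * (192 / ((F.L : ℝ) ^ k) ^ 2)) := by simp only [Finset.sum_const, Finset.card_univ, Fintype.card_fin, nsmul_eq_mul]; norm_num
  calc |∑ y ∈ T, ∑ α : Fin 3, A ⟨y, α⟩ * curlAt (obKernel F K k y α) z μ ν| ≤ ∑ y ∈ T, |∑ α : Fin 3, A ⟨y, α⟩ * curlAt (obKernel F K k y α) z μ ν| :=
        Finset.abs_sum_le_sum_abs _ _
    _ ≤ ∑ _y ∈ T, 3 * (M * (192 / ((F.L : ℝ) ^ k) ^ 2)) := Finset.sum_le_sum hterm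
    _ = T.card * (3 * (M * (192 / ((F.L : ℝ) ^ k) ^ 2))) := by rw [Finset.sum_const, nsmul_eq_mul]
    _ ≤ 3 * (3 * (M * (192 / ((F.L : ℝ) ^ k) ^ 2))) := by
        have : (T.card : ℝ) ≤ 3 := by exact_mod_cast hcardT
        have h0 : 0 ≤ 3 * (M * (192 / ((F.L : ℝ) ^ k) ^ 2)) := by positivity
        exact mul_le_mul_of_nonneg_right this h0
    _ = 1728 / ((F.L : ℝ) ^ k) ^ 2 * M := by ring

/-- **GLOBAL CURL BOUND**: `|A| ≤ M ⇒ |curl (obLift A)(z; μ, ν)| ≤ (1728/L^{2k})·M`. [cite: Balaban1987RG1, (0.11) p.253] -/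
theorem abs_curlAt_obLift_le (hk : k ≤ K) (hn3 : 3 ≤ F.L ^ k) (A : PBond (F.P K) k → ℝ) {M : ℝ} (hM : ∀ c, |A c| ≤ M) (z : Site (F.P K) 0) {μ ν : Fin 3} (hμν : μ ≠ ν) :
    |curlAt (obLift F K k A) z μ ν| ≤ 1728 / ((F.L : ℝ) ^ k) ^ 2 * M :=
  abs_curlAt_obLift_le_local hk hn3 A z hμν ((abs_nonneg _).trans (hM ⟨coarsen k z, 0⟩)) fun y α _ => hM ⟨y, α⟩

end Summit.QuantumFields.YangMills.Theorems.AbelianEML.OneBlock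

end
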